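import Literature.Geometry.Riemannian.LusternikFetSublevel
import HarnessLib

/-!
# Proof of `PaternainSaloUhlmann2023_contractible_sublevel` (Paternain–Salo–Uhlmann 2023, Prop. 3.7.22)

Discharge of the named fact of `NonTrappingConvexSublevel.lean`: **a compact non-trapping
Riemannian manifold with strictly convex boundary is contractible** (closed-manifold sublevel
form). PSU's printed proof uses a no-return extension and Serre's theorem (infinitely many
geodesics between two points of a non-contractible complete manifold); the proof formalised here
is the route of their Remark 3.7.23 — a compact non-contractible manifold with strictly convex
boundary carries a closed geodesic in its interior (Thorbergsson 1978), which is trapped — with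
the closed geodesic produced by the elementary Birkhoff curve-shortening / Lusternik–Fet
argument:

* `exists_homotopy_of_free_deformation` — the **cube trick**: a deformation of a based loop family
  through FREE loops to constant loops yields a homotopy of the based family to the constant
  family relative to the ends (conjugate by the base-point path, then contract the tent);
* `Cube.splitAt_boundary` — bookkeeping on `∂I^k`;
* `subsingleton_homotopyGroup_setOf_lt` — **`π_k({ρ < 0}) = 0` for all `k ≥ 1`**: a generalised
  loop `(I^k, ∂I^k) → ({ρ < 0}, x₀)` is a family over `I^{k-1}` of based loops; sample
  (`exists_nat_forall_edist_lt`), deform (`exists_deformation_to_const`, where non-trapping and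
  strict convexity enter), and apply the cube trick;
* `PaternainSaloUhlmann2023_contractible_sublevel_holds` — the fact, through the tree's reduction
  `contractibleSpace_sublevel_of_subsingleton_homotopyGroup` (Whitehead's theorem for manifolds +
  the collar deformation `{ρ ≤ 0} ≃ {ρ < 0}`, `NonTrappingConvexSublevelProofs.lean`).

No definitions, no named facts (D-0026); net debt `-1`.

## References

* G. P. Paternain, M. Salo, G. Uhlmann, *Geometric inverse problems, with emphasis on two
  dimensions*, CUP 2023, Prop. 3.7.22 and Remark 3.7.23 (PDF pp. 94–95). [PaternainSaloUhlmann2023]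
* J. Milnor, *Morse theory*, Princeton 1963, §16. [Milnor1963]
-/

noncomputable section

open Bundle Set Filter Function Metric Manifold
open scoped Manifold ContDiff Topology ENNReal NNReal

namespace Literature.Geometry.Riemannian

open Literature.Geometry.Lorentzian
open Literature.Geometry.Lorentzian.PseudoRiemannianMetric

/-! ### The cube trick: from a free deformation of a based loop family to a homotopy rel endpoints -/

section CubeTrick

variable {Xp Y : Type*} [TopologicalSpace Xp] [TopologicalSpace Y]

/-- **The cube trick** (elementary homotopy bookkeeping behind `π_k(X) ≅ π_{k-1}(ΛX, X)` for the
free loop space fibration, as used in the Lusternik–Fet argument). Let `f : Xp × [0,1] → Y` be a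
family of loops based at `y₀` (`f(x, 0) = f(x, 1) = y₀`), constant `y₀` over `A ⊆ Xp`, and let
`G : Xp × [0,1] × [0,1] → Y` be a deformation of `f` (`G(x, t, 0) = f(x, t)`) through families of
FREE loops (`G(x, 0, r) = G(x, 1, r)`), constant `y₀` over `A`, ending at a family of constant
loops (`G(x, t, 1)` independent of `t`). Then `f` is homotopic, relative to `t ∈ {0, 1}` and to
`A`, to the constant family `y₀`: conjugate the loop `G(x, ·, r)` by the base-point path
`r' ↦ G(x, 0, r')` (stage 1, after reparametrising `f`, stage 0), arriving at the "tent"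
`Φ(β(t))`, which contracts along itself (stage 2). [folklore] -/
theorem exists_homotopy_of_free_deformation {A : Set Xp} {y₀ : Y} {f : Xp → ℝ → Y}
    {G : Xp → ℝ → ℝ → Y}
    (hf : Continuous fun p : Xp × ℝ ↦ f p.1 p.2)
    (hG : Continuous fun p : Xp × ℝ × ℝ ↦ G p.1 p.2.1 p.2.2)
    (hf0 : ∀ x, f x 0 = y₀) (hf1 : ∀ x, f x 1 = y₀)
    (h0 : ∀ x, ∀ t ∈ Icc (0 : ℝ) 1, G x t 0 = f x t)
    (h1 : ∀ x t t', G x t 1 = G x t' 1)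
    (hl : ∀ x r, G x 0 r = G x 1 r)
    (hA : ∀ x ∈ A, ∀ t r, G x t r = y₀) (hfA : ∀ x ∈ A, ∀ t, f x t = y₀) :
    ∃ K : Xp → ℝ → ℝ → Y, Continuous (fun p : Xp × ℝ × ℝ ↦ K p.1 p.2.1 p.2.2) ∧
      (∀ x, ∀ t ∈ Icc (0 : ℝ) 1, K x t 0 = f x t) ∧ (∀ x t, K x t 1 = y₀) ∧
      (∀ x s, K x 0 s = y₀) ∧ (∀ x s, K x 1 s = y₀) ∧ (∀ x ∈ A, ∀ t s, K x t s = y₀) := by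
  -- the clamp onto `[0, 1]`
  set c : ℝ → ℝ := fun t ↦ max 0 (min t 1) with hc
  have hcc : Continuous c := continuous_const.max (continuous_id.min continuous_const)
  have hcm : ∀ t, c t ∈ Icc (0 : ℝ) 1 := fun t ↦ ⟨le_max_left _ _, max_le zero_le_one (min_le_right _ _)⟩
  have hc0 : c 0 = 0 := by simp [hc]
  have hc1 : c 1 = 1 := by simp [hc]
  have hc_of_le : ∀ t, t ≤ 0 → c t = 0 := fun t ht ↦ by
    simp only [hc]; rw [max_eq_left (le_trans (min_le_left _ _) ht)]
  have hc_of_ge : ∀ t, 1 ≤ t → c t = 1 := fun t ht ↦ by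
    simp only [hc]; rw [min_eq_right ht, max_eq_right zero_le_one]
  have hc_id : ∀ t ∈ Icc (0 : ℝ) 1, c t = t := fun t ht ↦ by
    simp only [hc]; rw [min_eq_left ht.2, max_eq_right ht.1]
  -- the base-point path and the three stages
  set Φ : Xp → ℝ → Y := fun x r ↦ G x 0 r with hΦ
  have hΦ0 : ∀ x, Φ x 0 = y₀ := fun x ↦ by
    show G x 0 0 = y₀; rw [h0 x 0 ⟨le_rfl, zero_le_one⟩, hf0]
  set S0 : Xp → ℝ → ℝ → Y := fun x t s ↦ f x ((1 - s) * t + s * c (3 * t - 1)) with hS0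
  set S1 : Xp → ℝ → ℝ → Y := fun x t s ↦
    if t ≤ 1 / 3 then Φ x (s * c (3 * t)) else if t ≤ 2 / 3 then G x (c (3 * t - 1)) s
      else Φ x (s * c (3 - 3 * t)) with hS1
  set β : ℝ → ℝ := fun t ↦ c (min (3 * t) (3 - 3 * t)) with hβ
  set S2 : Xp → ℝ → ℝ → Y := fun x t s ↦ Φ x ((1 - s) * β t) with hS2
  -- continuity of the stages
  have hΦc : Continuous fun p : Xp × ℝ ↦ Φ p.1 p.2 :=
    hG.comp (continuous_fst.prodMk (continuous_const.prodMk continuous_snd))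
  have hS0c : Continuous fun p : Xp × ℝ × ℝ ↦ S0 p.1 p.2.1 p.2.2 := by
    refine hf.comp (continuous_fst.prodMk ?_)
    exact ((continuous_const.sub (continuous_snd.comp continuous_snd)).mul
      (continuous_fst.comp continuous_snd)).add
      ((continuous_snd.comp continuous_snd).mul
        (hcc.comp ((continuous_const.mul (continuous_fst.comp continuous_snd)).sub continuous_const)))
  have ht_c : Continuous fun p : Xp × ℝ × ℝ ↦ p.2.1 := continuous_fst.comp continuous_snd
  have hs_c : Continuous fun p : Xp × ℝ × ℝ ↦ p.2.2 := continuous_snd.comp continuous_snd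
  have hS1c : Continuous fun p : Xp × ℝ × ℝ ↦ S1 p.1 p.2.1 p.2.2 := by
    have hb1 : Continuous fun p : Xp × ℝ × ℝ ↦ Φ p.1 (p.2.2 * c (3 * p.2.1)) :=
      hΦc.comp (continuous_fst.prodMk (hs_c.mul (hcc.comp (continuous_const.mul ht_c))))
    have hb2 : Continuous fun p : Xp × ℝ × ℝ ↦ G p.1 (c (3 * p.2.1 - 1)) p.2.2 :=
      hG.comp (continuous_fst.prodMk ((hcc.comp ((continuous_const.mul ht_c).sub continuous_const)).prodMk hs_c))
    have hb3 : Continuous fun p : Xp × ℝ × ℝ ↦ Φ p.1 (p.2.2 * c (3 - 3 * p.2.1)) :=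
      hΦc.comp (continuous_fst.prodMk (hs_c.mul (hcc.comp (continuous_const.sub (continuous_const.mul ht_c)))))
    have hinner : Continuous fun p : Xp × ℝ × ℝ ↦
        if p.2.1 ≤ 2 / 3 then G p.1 (c (3 * p.2.1 - 1)) p.2.2 else Φ p.1 (p.2.2 * c (3 - 3 * p.2.1)) := by
      refine Continuous.if_le hb2 hb3 ht_c continuous_const ?_
      rintro ⟨x, t, s⟩ (ht : t = 2 / 3)
      show G x (c (3 * t - 1)) s = Φ x (s * c (3 - 3 * t))
      rw [ht, show (3 : ℝ) * (2 / 3) - 1 = 1 by norm_num, show (3 : ℝ) - 3 * (2 / 3) = 1 by norm_num, hc1,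
        mul_one]
      show G x 1 s = G x 0 s
      exact (hl x s).symm
    refine Continuous.if_le hb1 hinner ht_c continuous_const ?_
    rintro ⟨x, t, s⟩ (ht : t = 1 / 3)
    show Φ x (s * c (3 * t)) = if t ≤ 2 / 3 then G x (c (3 * t - 1)) s else Φ x (s * c (3 - 3 * t))
    rw [if_pos (by rw [ht]; norm_num), ht, show (3 : ℝ) * (1 / 3) = 1 by norm_num,
      show (1 : ℝ) - 1 = 0 by norm_num, hc1, hc0, mul_one]
  have hβc : Continuous β := hcc.comp ((continuous_const.mul continuous_id).min
    (continuous_const.sub (continuous_const.mul continuous_id)))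
  have hS2c : Continuous fun p : Xp × ℝ × ℝ ↦ S2 p.1 p.2.1 p.2.2 :=
    hΦc.comp (continuous_fst.prodMk ((continuous_const.sub hs_c).mul (hβc.comp ht_c)))
  -- matching of the stages
  have hmatch01 : ∀ x t, S0 x t 1 = S1 x t 0 := by
    intro x t
    show f x ((1 - 1) * t + 1 * c (3 * t - 1)) =
      if t ≤ 1 / 3 then Φ x (0 * c (3 * t)) else if t ≤ 2 / 3 then G x (c (3 * t - 1)) 0
        else Φ x (0 * c (3 - 3 * t))
    rw [sub_self, zero_mul, zero_add, one_mul]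
    by_cases ht1 : t ≤ 1 / 3
    · rw [if_pos ht1, zero_mul, hΦ0, hc_of_le _ (by linarith), hf0]
    · rw [if_neg ht1]
      by_cases ht2 : t ≤ 2 / 3
      · rw [if_pos ht2, h0 x _ (hcm _)]
      · rw [if_neg ht2, zero_mul, hΦ0, hc_of_ge _ (by linarith), hf1]
  have hmatch12 : ∀ x t, S1 x t 1 = S2 x t 0 := by
    intro x t
    show (if t ≤ 1 / 3 then Φ x (1 * c (3 * t)) else if t ≤ 2 / 3 then G x (c (3 * t - 1)) 1
        else Φ x (1 * c (3 - 3 * t))) = Φ x ((1 - 0) * β t)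
    rw [sub_zero, one_mul, one_mul, one_mul]
    by_cases ht1 : t ≤ 1 / 3
    · rw [if_pos ht1]
      show Φ x (c (3 * t)) = Φ x (c (min (3 * t) (3 - 3 * t)))
      rw [min_eq_left (by linarith)]
    · rw [if_neg ht1]
      by_cases ht2 : t ≤ 2 / 3
      · rw [if_pos ht2, h1 x _ 0]
        show Φ x 1 = Φ x (c (min (3 * t) (3 - 3 * t)))
        rw [hc_of_ge _ (le_min (by linarith) (by linarith))]
      · rw [if_neg ht2]
        show Φ x (c (3 - 3 * t)) = Φ x (c (min (3 * t) (3 - 3 * t)))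
        rw [min_eq_right (by linarith)]
  -- the glued homotopy, with the parameter clamped and rescaled to `[0, 1]`
  set Q : Xp × ℝ → Fin 3 → ℝ → Y := fun p j ↦ ![S0 p.1 p.2, S1 p.1 p.2, S2 p.1 p.2] j with hQ
  set K : Xp → ℝ → ℝ → Y := fun x t s ↦ glueFin (Q (x, t)) (3 * c s) with hK
  have hQ0 : ∀ p, Q p 0 = S0 p.1 p.2 := fun p ↦ rfl
  have hQ1 : ∀ p, Q p 1 = S1 p.1 p.2 := fun p ↦ rfl
  have hQ2 : ∀ p, Q p 2 = S2 p.1 p.2 := fun p ↦ rfl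
  have hglue : ContinuousOn (fun q : (Xp × ℝ) × ℝ ↦ glueFin (Q q.1) q.2) (univ ×ˢ Icc 0 ((3 : ℕ) : ℝ)) := by
    refine continuousOn_glueFin (Q := Q) (fun j ↦ ?_) (fun p i j hij ↦ ?_)
    · fin_cases j
      · exact (hS0c.comp ((continuous_fst.comp continuous_fst).prodMk
          ((continuous_snd.comp continuous_fst).prodMk continuous_snd))).continuousOn
      · exact (hS1c.comp ((continuous_fst.comp continuous_fst).prodMk
          ((continuous_snd.comp continuous_fst).prodMk continuous_snd))).continuousOn
      · exact (hS2c.comp ((continuous_fst.comp continuous_fst).prodMk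
          ((continuous_snd.comp continuous_fst).prodMk continuous_snd))).continuousOn
    · fin_cases i <;> fin_cases j <;> simp at hij
      · exact hmatch01 p.1 p.2
      · exact hmatch12 p.1 p.2
  have hKc : Continuous fun p : Xp × ℝ × ℝ ↦ K p.1 p.2.1 p.2.2 := by
    have h1 : Continuous fun p : Xp × ℝ × ℝ ↦ (((p.1, p.2.1) : Xp × ℝ), 3 * c p.2.2) :=
      (continuous_fst.prodMk ht_c).prodMk (continuous_const.mul (hcc.comp hs_c))
    refine hglue.comp_continuous h1 fun p ↦ ⟨mem_univ _, ?_⟩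
    have := hcm p.2.2
    exact ⟨by nlinarith [this.1], by push_cast; nlinarith [this.2]⟩
  -- values of all stages on `t = 0`, `t = 1` and over `A`
  have hS0_0 : ∀ x s, S0 x 0 s = y₀ := fun x s ↦ by
    show f x ((1 - s) * 0 + s * c (3 * 0 - 1)) = y₀
    rw [mul_zero, zero_add, mul_zero, zero_sub, hc_of_le _ (by norm_num), mul_zero, hf0]
  have hS0_1 : ∀ x s, S0 x 1 s = y₀ := fun x s ↦ by
    show f x ((1 - s) * 1 + s * c (3 * 1 - 1)) = y₀
    rw [mul_one, show (3 : ℝ) * 1 - 1 = 2 by norm_num, hc_of_ge _ (by norm_num), mul_one, sub_add_cancel, hf1]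
  have hS1_0 : ∀ x s, S1 x 0 s = y₀ := fun x s ↦ by
    show (if (0 : ℝ) ≤ 1 / 3 then Φ x (s * c (3 * 0)) else _) = y₀
    rw [if_pos (by norm_num), mul_zero, hc0, mul_zero, hΦ0]
  have hS1_1 : ∀ x s, S1 x 1 s = y₀ := fun x s ↦ by
    show (if (1 : ℝ) ≤ 1 / 3 then Φ x (s * c (3 * 1)) else if (1 : ℝ) ≤ 2 / 3 then G x (c (3 * 1 - 1)) s
      else Φ x (s * c (3 - 3 * 1))) = y₀
    rw [if_neg (by norm_num), if_neg (by norm_num), mul_one, sub_self, hc0, mul_zero, hΦ0]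
  have hβ0 : β 0 = 0 := by show c (min (3 * 0) (3 - 3 * 0)) = 0; norm_num [hc0]
  have hβ1 : β 1 = 0 := by show c (min (3 * 1) (3 - 3 * 1)) = 0; norm_num [hc0]
  have hS2_0 : ∀ x s, S2 x 0 s = y₀ := fun x s ↦ by
    show Φ x ((1 - s) * β 0) = y₀; rw [hβ0, mul_zero, hΦ0]
  have hS2_1 : ∀ x s, S2 x 1 s = y₀ := fun x s ↦ by
    show Φ x ((1 - s) * β 1) = y₀; rw [hβ1, mul_zero, hΦ0]
  have hΦA : ∀ x ∈ A, ∀ r, Φ x r = y₀ := fun x hx r ↦ hA x hx 0 r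
  have hSA : ∀ x ∈ A, ∀ t s, S0 x t s = y₀ ∧ S1 x t s = y₀ ∧ S2 x t s = y₀ := by
    intro x hx t s
    refine ⟨hfA x hx _, ?_, hΦA x hx _⟩
    show (if t ≤ 1 / 3 then Φ x (s * c (3 * t)) else if t ≤ 2 / 3 then G x (c (3 * t - 1)) s
      else Φ x (s * c (3 - 3 * t))) = y₀
    split_ifs
    · exact hΦA x hx _
    · exact hA x hx _ _
    · exact hΦA x hx _
  -- the glued map on a column where all stages are constant
  have hKconst : ∀ x t, (∀ s, S0 x t s = y₀) → (∀ s, S1 x t s = y₀) → (∀ s, S2 x t s = y₀) →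
      ∀ s, K x t s = y₀ := by
    intro x t h₀ h₁ h₂ s
    show glueFin (Q (x, t)) (3 * c s) = y₀
    rw [glueFin_eq]
    generalize pieceIndex 3 (3 * c s) = j
    fin_cases j
    · exact h₀ _
    · exact h₁ _
    · exact h₂ _
  refine ⟨K, hKc, ?_, ?_, ?_, ?_, ?_⟩
  · -- `K x t 0 = f x t`
    intro x t ht
    show glueFin (Q (x, t)) (3 * c 0) = f x t
    rw [hc0, mul_zero]
    have h := glueFin_natCast (Q (x, t)) (0 : Fin 3)
    rw [Fin.val_zero, Nat.cast_zero] at h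
    rw [h, hQ0]
    show f x ((1 - 0) * t + 0 * c (3 * t - 1)) = f x t
    rw [sub_zero, one_mul, zero_mul, add_zero]
  · -- `K x t 1 = y₀`
    intro x t
    show glueFin (Q (x, t)) (3 * c 1) = y₀
    rw [hc1, mul_one, show (3 : ℝ) = ((3 : ℕ) : ℝ) by norm_num, glueFin_last]
    show S2 x t 1 = y₀
    show Φ x ((1 - 1) * β t) = y₀
    rw [sub_self, zero_mul, hΦ0]
  · exact fun x s ↦ hKconst x 0 (hS0_0 x) (hS1_0 x) (hS2_0 x) s
  · exact fun x s ↦ hKconst x 1 (hS0_1 x) (hS1_1 x) (hS2_1 x) s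
  · exact fun x hx t s ↦ hKconst x t (fun s ↦ (hSA x hx t s).1) (fun s ↦ (hSA x hx t s).2.1)
      (fun s ↦ (hSA x hx t s).2.2) s

end CubeTrick

/-! ### Splitting a cube boundary -/

section CubeBoundary

/-- A point of `∂I^N` has its `i`-th coordinate in `{0, 1}` or its remaining coordinates in
`∂I^{N ∖ {i}}`. [folklore] -/
theorem Cube.splitAt_boundary {N : Type*} [DecidableEq N] (i : N) {y : N → unitInterval}
    (hy : y ∈ Cube.boundary N) :
    (y i = 0 ∨ y i = 1) ∨ (fun j : {j // j ≠ i} ↦ y j) ∈ Cube.boundary {j // j ≠ i} := by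
  obtain ⟨j, hj⟩ := hy
  by_cases hji : j = i
  · subst hji; exact Or.inl hj
  · exact Or.inr ⟨⟨j, hji⟩, hj⟩

end CubeBoundary

/-! ### Weak contractibility of the interior of a non-trapping strictly convex domain -/

section Assembly

variable {E : Type*} [NormedAddCommGroup E] [NormedSpace ℝ E] {H : Type*} [TopologicalSpace H]
  {I : ModelWithCorners ℝ E H} {M : Type*} [TopologicalSpace M] [ChartedSpace H M]
  [IsManifold I ∞ M] {n : ℕ∞ω} [FiniteDimensional ℝ E] [CompleteSpace E] [T2Space M]
  [I.Boundaryless] [CompactSpace M]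
  {g : PseudoRiemannianMetric I n E (TangentSpace I : M → Type _)} [g.HasLeviCivita]

/-- **The homotopy groups of the interior of a compact non-trapping manifold with strictly convex
boundary vanish** (the geometric core of Paternain–Salo–Uhlmann 2023, Prop. 3.7.22 through the
closed-geodesic route of Remark 3.7.23 / Thorbergsson 1978, made effective by Birkhoff's
curve-shortening: `exists_deformation_to_const`). In the sublevel form of
`PaternainSaloUhlmann2023_contractible_sublevel` (compact `M`, smooth Riemannian `g`, smooth `ρ`
with `{ρ ≤ 0}` strictly convex and non-trapping): for every `k ≥ 1` and base point,
`π_k({ρ < 0}) = 0`. Proof: a based map `p : (I^k, ∂I^k) → ({ρ < 0}, x₀)` is a family over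
`I^{k-1}` of loops based at `x₀`, constant over `∂I^{k-1}`; after sampling
(`exists_nat_forall_edist_lt`) the deformation theorem contracts it through families of free
loops in `{ρ < 0}`, and the cube trick (`exists_homotopy_of_free_deformation`) converts this into a
homotopy of `p` to the constant map relative to `∂I^k`.
[cite: PaternainSaloUhlmann2023, Prop. 3.7.22 and Remark 3.7.23] -/
theorem subsingleton_homotopyGroup_setOf_lt (hn : (∞ : ℕ∞ω) ≤ n) (hg : g.IsRiemannian) {ρ : M → ℝ}
    (hρ : ContMDiff I 𝓘(ℝ, ℝ) ∞ ρ) (hconv : IsStrictlyConvexSublevel g ρ) (hnt : IsNonTrappingSublevel g ρ)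
    (k : ℕ) (hk : 1 ≤ k) (x₀ : ({x : M | ρ x < 0} : Set M)) :
    Subsingleton (π_ k ({x : M | ρ x < 0} : Set M) x₀) := by
  classical
  haveI : Fact (1 ≤ n) := ⟨le_trans (by exact_mod_cast le_top) hn⟩
  -- it suffices to contract every generalised loop
  suffices key : ∀ p : GenLoop (Fin k) ({x : M | ρ x < 0} : Set M) x₀, GenLoop.Homotopic p GenLoop.const by
    refine ⟨fun a b ↦ Quotient.inductionOn₂ a b fun p q ↦ Quotient.sound ?_⟩
    exact (key p).trans (key q).symm
  intro p
  -- constants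
  have hε := uniformNormalRadius_pos hn hg
  set ε := uniformNormalRadius g hn hg with hε_def
  obtain ⟨ℓ₀, hℓ₀, hgeo⟩ := hconv.exists_pos_forall_isGeodesic hg hρ
  have hstay : ∀ γ : ℝ → M, IsGeodesic g.leviCivita γ →
      g.val (γ 0) (velocity I γ 0) (velocity I γ 0) < ℓ₀ ^ 2 →
      ρ (γ 0) ≤ 0 → ρ (γ 1) ≤ 0 → ∀ t ∈ Icc (0 : ℝ) 1, ρ (γ t) ≤ 0 :=
    fun γ hγ hsp ↦ (hgeo γ hγ hsp).1
  have hstay' : ∀ γ : ℝ → M, IsGeodesic g.leviCivita γ →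
      g.val (γ 0) (velocity I γ 0) (velocity I γ 0) < ℓ₀ ^ 2 →
      ρ (γ 0) < 0 → ρ (γ 1) < 0 → ∀ t ∈ Icc (0 : ℝ) 1, ρ (γ t) < 0 :=
    fun γ hγ hsp ↦ (hgeo γ hγ hsp).2
  set ε₁ : ℝ := min ε ℓ₀ / 4 with hε₁_def
  have hε₁ : 0 < ε₁ := by positivity
  have h3ε : 3 * ε₁ < ε := by
    have : min ε ℓ₀ ≤ ε := min_le_left _ _
    rw [hε₁_def]; linarith
  have h3ℓ : 3 * ε₁ < ℓ₀ := by
    have : min ε ℓ₀ ≤ ℓ₀ := min_le_right _ _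
    rw [hε₁_def]; linarith
  -- the loop coordinate `i` and the family of loops
  set i : Fin k := ⟨0, hk⟩ with hi
  set Xp := {j : Fin k // j ≠ i} → unitInterval with hXp
  set A : Set Xp := Cube.boundary {j : Fin k // j ≠ i} with hA
  set f₁ : Xp × ℝ → ({x : M | ρ x < 0} : Set M) := fun q ↦ p (Cube.insertAt i (Set.projIcc 0 1 zero_le_one q.2, q.1)) with hf₁
  have hf₁c : Continuous f₁ :=
    p.1.continuous.comp ((Cube.insertAt i).continuous.comp
      ((continuous_projIcc.comp continuous_snd).prodMk continuous_fst))
  have hf₁0 : ∀ x, f₁ (x, 0) = x₀ := fun x ↦ by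
    show p (Cube.insertAt i (Set.projIcc 0 1 zero_le_one 0, x)) = x₀
    rw [Set.projIcc_left]
    exact p.2 _ (Cube.insertAt_boundary i (Or.inl (Or.inl rfl)))
  have hf₁1 : ∀ x, f₁ (x, 1) = x₀ := fun x ↦ by
    show p (Cube.insertAt i (Set.projIcc 0 1 zero_le_one 1, x)) = x₀
    rw [Set.projIcc_right]
    exact p.2 _ (Cube.insertAt_boundary i (Or.inl (Or.inr rfl)))
  have hf₁A : ∀ x ∈ A, ∀ t, f₁ (x, t) = x₀ := fun x hx t ↦
    p.2 _ (Cube.insertAt_boundary i (Or.inr hx))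
  -- sampling
  obtain ⟨N, hN1, hfineN⟩ := exists_nat_forall_edist_lt hg (F := fun q : Xp × ℝ ↦ (f₁ q : M))
    (continuous_subtype_val.comp hf₁c) hε₁
  haveI : NeZero N := ⟨by omega⟩
  have hNpos : (0 : ℝ) < N := by exact_mod_cast (show 0 < N by omega)
  set F : Xp × ℝ → M := fun q ↦ (f₁ (q.1, q.2 / N) : M) with hF
  have hFc : Continuous F :=
    continuous_subtype_val.comp (hf₁c.comp (continuous_fst.prodMk (continuous_snd.div_const _)))
  have hloop : ∀ x, F (x, 0) = F (x, N) := fun x ↦ by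
    show (f₁ (x, 0 / N) : M) = f₁ (x, N / N)
    rw [zero_div, div_self hNpos.ne', hf₁0, hf₁1]
  have hFD : ∀ x, ∀ t ∈ Icc (0 : ℝ) N, ρ (F (x, t)) < 0 := fun x t _ ↦ (f₁ (x, t / N)).2
  have hFA : ∀ x ∈ A, ∀ t, F (x, t) = x₀ := fun x hx t ↦ by
    show (f₁ (x, t / N) : M) = x₀; rw [hf₁A x hx]
  have hfine : ∀ (x : Xp) (s t : ℝ), s ∈ Icc (0 : ℝ) N → t ∈ Icc (0 : ℝ) N → |s - t| ≤ 1 →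
      g.edist hg (F (x, s)) (F (x, t)) < ENNReal.ofReal ε₁ := by
    intro x s t hs ht hst
    refine hfineN x (s / N) (t / N) ⟨div_nonneg hs.1 hNpos.le, (div_le_one hNpos).2 hs.2⟩
      ⟨div_nonneg ht.1 hNpos.le, (div_le_one hNpos).2 ht.2⟩ ?_
    rw [← sub_div, abs_div, abs_of_pos hNpos, div_le_div_iff_of_pos_right hNpos]
    exact hst
  -- the deformation
  obtain ⟨L, _, Hh, hHc, hH0, hH1, hHl, hHA, hHD⟩ := exists_deformation_to_const hn hg (X := Xp)
    hρ.continuous hnt hstay hstay' hε₁ h3ε h3ℓ hFc hloop hFD hFA hfine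
  have hLpos : (0 : ℝ) < L := by exact_mod_cast NeZero.pos L
  -- clamp to `[0, L]`
  set cL : ℝ → ℝ := fun u ↦ max 0 (min u L) with hcL
  have hcLm : ∀ u, cL u ∈ Icc (0 : ℝ) L := fun u ↦ ⟨le_max_left _ _, max_le hLpos.le (min_le_right _ _)⟩
  have hcLc : Continuous cL := continuous_const.max (continuous_id.min continuous_const)
  have hcL_of_mem : ∀ u ∈ Icc (0 : ℝ) L, cL u = u := fun u hu ↦ by
    show max 0 (min u L) = u; rw [min_eq_left hu.2, max_eq_right hu.1]
  set c : ℝ → ℝ := fun t ↦ max 0 (min t 1) with hc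
  have hcc : Continuous c := continuous_const.max (continuous_id.min continuous_const)
  have hc0 : c 0 = 0 := by simp [hc]
  have hc1 : c 1 = 1 := by simp [hc]
  have hc_id : ∀ t ∈ Icc (0 : ℝ) 1, c t = t := fun t ht ↦ by
    show max 0 (min t 1) = t; rw [min_eq_left ht.2, max_eq_right ht.1]
  -- the free deformation, lifted to the interior and rescaled to the unit square
  set G : Xp → ℝ → ℝ → ({x : M | ρ x < 0} : Set M) := fun x t r ↦
    ⟨Hh (x, N * c t) (cL (L * r)), hHD x _ _ (hcLm _)⟩ with hG
  have hGc : Continuous fun q : Xp × ℝ × ℝ ↦ G q.1 q.2.1 q.2.2 := by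
    refine Continuous.subtype_mk ?_ _
    have h1 : Continuous fun q : Xp × ℝ × ℝ ↦ (((q.1, N * c q.2.1) : Xp × ℝ), cL (L * q.2.2)) :=
      (continuous_fst.prodMk (continuous_const.mul (hcc.comp (continuous_fst.comp continuous_snd)))).prodMk
        (hcLc.comp (continuous_const.mul (continuous_snd.comp continuous_snd)))
    exact hHc.comp_continuous h1 fun q ↦ ⟨mem_univ _, hcLm _⟩
  set f : Xp → ℝ → ({x : M | ρ x < 0} : Set M) := fun x t ↦ f₁ (x, t) with hf
  have hfc : Continuous fun q : Xp × ℝ ↦ f q.1 q.2 := hf₁c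
  have h0 : ∀ x, ∀ t ∈ Icc (0 : ℝ) 1, G x t 0 = f x t := by
    intro x t ht
    apply Subtype.ext
    show Hh (x, N * c t) (cL (L * 0)) = (f₁ (x, t) : M)
    rw [mul_zero, hcL_of_mem 0 ⟨le_rfl, hLpos.le⟩, hc_id t ht,
      hH0 x _ ⟨mul_nonneg hNpos.le ht.1, mul_le_of_le_one_right hNpos.le ht.2⟩]
    show (f₁ (x, N * t / N) : M) = f₁ (x, t)
    rw [mul_div_cancel_left₀ _ hNpos.ne']
  have h1 : ∀ x t t', G x t 1 = G x t' 1 := by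
    intro x t t'
    apply Subtype.ext
    show Hh (x, N * c t) (cL (L * 1)) = Hh (x, N * c t') (cL (L * 1))
    rw [mul_one, hcL_of_mem L ⟨hLpos.le, le_rfl⟩]
    exact hH1 x _ _
  have hl : ∀ x r, G x 0 r = G x 1 r := by
    intro x r
    apply Subtype.ext
    show Hh (x, N * c 0) (cL (L * r)) = Hh (x, N * c 1) (cL (L * r))
    rw [hc0, hc1, mul_zero, mul_one]
    exact hHl x _
  have hGA : ∀ x ∈ A, ∀ t r, G x t r = x₀ := fun x hx t r ↦ Subtype.ext (hHA x hx _ _)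
  have hfA : ∀ x ∈ A, ∀ t, f x t = x₀ := fun x hx t ↦ hf₁A x hx t
  -- the cube trick
  obtain ⟨K, hKc, hK0, hK1, hKt0, hKt1, hKA⟩ := exists_homotopy_of_free_deformation (Y := ({x : M | ρ x < 0} : Set M))
    hfc hGc hf₁0 hf₁1 h0 h1 hl hGA hfA
  -- the homotopy of generalised loops
  refine ⟨{
    toFun := fun q ↦ K (Cube.splitAt i q.2).2 ((Cube.splitAt i q.2).1 : ℝ) (q.1 : ℝ)
    continuous_toFun := ?_
    map_zero_left := ?_
    map_one_left := ?_
    prop' := ?_ }⟩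
  · have h1 : Continuous fun q : unitInterval × (Fin k → unitInterval) ↦
        (((Cube.splitAt i q.2).2 : Xp), (((Cube.splitAt i q.2).1 : ℝ), (q.1 : ℝ))) :=
      ((continuous_snd.comp ((Cube.splitAt i).continuous.comp continuous_snd))).prodMk
        ((continuous_subtype_val.comp (continuous_fst.comp
          ((Cube.splitAt i).continuous.comp continuous_snd))).prodMk
          (continuous_subtype_val.comp continuous_fst))
    exact hKc.comp h1
  · intro y
    show K (Cube.splitAt i y).2 ((Cube.splitAt i y).1 : ℝ) ((0 : unitInterval) : ℝ) = p y
    rw [show ((0 : unitInterval) : ℝ) = 0 from rfl, hK0 _ _ (Cube.splitAt i y).1.2]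
    show f₁ ((Cube.splitAt i y).2, ((Cube.splitAt i y).1 : ℝ)) = p y
    show p (Cube.insertAt i (Set.projIcc 0 1 zero_le_one ((Cube.splitAt i y).1 : ℝ), (Cube.splitAt i y).2)) = p y
    rw [Set.projIcc_val zero_le_one]
    show p ((Cube.insertAt i) ((Cube.splitAt i) y)) = p y
    rw [show (Cube.insertAt i) ((Cube.splitAt i) y) = y from (Cube.splitAt i).symm_apply_apply y]
  · intro y
    show K (Cube.splitAt i y).2 ((Cube.splitAt i y).1 : ℝ) ((1 : unitInterval) : ℝ) = GenLoop.const y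
    rw [show ((1 : unitInterval) : ℝ) = 1 from rfl, hK1]
    rfl
  · intro s y hy
    show K (Cube.splitAt i y).2 ((Cube.splitAt i y).1 : ℝ) (s : ℝ) = p y
    have hK : K (Cube.splitAt i y).2 ((Cube.splitAt i y).1 : ℝ) (s : ℝ) = x₀ := by
      rcases Cube.splitAt_boundary i hy with (h | h) | h
      · have : ((Cube.splitAt i y).1 : ℝ) = 0 := by
          show ((y i : unitInterval) : ℝ) = 0; rw [h]; rfl
        rw [this]; exact hKt0 _ _
      · have : ((Cube.splitAt i y).1 : ℝ) = 1 := by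
          show ((y i : unitInterval) : ℝ) = 1; rw [h]; rfl
        rw [this]; exact hKt1 _ _
      · exact hKA _ h _ _
    exact hK.trans (GenLoop.boundary p y hy).symm

end Assembly

/-! ### The named fact -/

/-- **Proof of `PaternainSaloUhlmann2023_contractible_sublevel`** (Paternain–Salo–Uhlmann 2023,
Prop. 3.7.22: a compact non-trapping Riemannian manifold with strictly convex boundary is
contractible; here in the tree's closed-manifold sublevel form). The printed proof goes through a
no-return extension and Serre's theorem on geodesics joining two points of a non-contractible
complete manifold; the proof given here is the route of PSU's Remark 3.7.23 (a non-contractible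
compact manifold with strictly convex boundary contains a closed geodesic in its interior,
Thorbergsson 1978, which would be trapped), with the closed geodesic produced by Birkhoff's
curve-shortening of geodesic polygons (Lusternik–Fet): `subsingleton_homotopyGroup_setOf_lt` shows
that all homotopy groups of the interior `{ρ < 0}` vanish, and the tree's reduction
`contractibleSpace_sublevel_of_subsingleton_homotopyGroup` (Whitehead's theorem for manifolds and
the collar deformation `{ρ ≤ 0} ≃ {ρ < 0}`) concludes.
[cite: PaternainSaloUhlmann2023, Prop. 3.7.22 and Remark 3.7.23] -/
theorem PaternainSaloUhlmann2023_contractible_sublevel_holds :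
    PaternainSaloUhlmann2023_contractible_sublevel := by
  intro d hd M _ _ _ _ _ _ g _ ρ hg hρ hne hconv hnt hconn
  exact contractibleSpace_sublevel_of_subsingleton_homotopyGroup g hρ hne hconv hconn
    (fun k hk x ↦ subsingleton_homotopyGroup_setOf_lt (I := 𝓡 d) le_rfl hg hρ hconv hnt k hk x)

end Literature.Geometry.Riemannian
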